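import Mathlib
import Literature.MathematicalPhysics.QuantumLattice.PairFieldMomentum
import HarnessLib

/-!
# Crux `WcbcsSsbToTorusLRO` (stmt-HubbardSuperconductivity-2009), line `off-zero-mode-moment-closure`:
# stub LAT `stub_windowLatticeSums` — two elementary 2-d lattice sums (proved)

Pure lattice geometry on the discrete torus `(ℤ/Lℤ)²`, no physics. With
`|q_m|² = momentumNormSq L m = (2π/L)² Σᵢ (valMinAbs mᵢ)²` (the Brillouin-zone momentum of the label
`m`, `PairFieldMomentum`), write `n = (valMinAbs m₀, valMinAbs m₁) ∈ ℤ²` and `j = ‖n‖_∞`. Then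

* the label `m ↦ n` is injective, so at most `4(2j+1)` labels have `‖n‖_∞ = j` (they inject into the
  boundary of the `(2j+1) × (2j+1)` square), `latCard_fiber_le`;
* `|q_m|² ≥ (2π/L)² j²` (`‖n‖₂ ≥ ‖n‖_∞`), and `m ≠ 0 ↔ j ≥ 1`.

Grouping both sums by `j` (`Finset.sum_fiberwise_of_maps_to`):

* (i) window sum: `m ≠ 0`, `|q_m|² < η²` force `1 ≤ j ≤ ηL/(2π)`, each term is `≤ L/(2πj)`, so the sum
  is `≤ Σ_{j ≤ ηL/(2π)} 4(2j+1) · L/(2πj) ≤ (3/π²) η L² ≤ η L² + L`;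
* (ii) punctured sum: each term is `≤ L²/(4π²j²)`, so the sum is
  `≤ Σ_{j=1}^{L} 4(2j+1) L²/(4π² j²) ≤ (3/π²) L² H_L ≤ L² (1 + log L)` by the harmonic bound
  `H_L ≤ 1 + log L` (Mathlib `harmonic_le_one_add_log`).

Hence the registered statement holds with the single absolute constant `c = 1`. Everything is folklore
(lattice-sum bookkeeping as in any infrared-bound argument, e.g. Kennedy–Lieb–Shastry 1988); no
definition of the tree is touched and no named fact is introduced.
-/

noncomputable section

set_option linter.dupNamespace false

namespace Summit.HubbardSuperconductivity.HubbardSuperconductivity.Theorems.WcbcsSsbToTorusLRO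

open Literature.MathematicalPhysics.QuantumLattice Literature.Probability.LatticeModels

/-! ## §1 The sup-norm of a momentum label and its fibres

Throughout, the sup-norm `‖n‖_∞ = max |n₀| |n₁|` of the least-absolute-value representative
`n = (valMinAbs m₀, valMinAbs m₁) ∈ ℤ²` of a label `m ∈ (ℤ/Lℤ)²` is written out as
`max (m 0).valMinAbs.natAbs (m 1).valMinAbs.natAbs : ℕ` (no auxiliary definition is introduced). -/

/-- A nonzero label has sup-norm at least `1`. [folklore] -/
theorem one_le_latLinf {L : ℕ} {m : TorusSite 2 L} (hm : m ≠ 0) :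
    1 ≤ max (m 0).valMinAbs.natAbs (m 1).valMinAbs.natAbs := by
  by_contra h
  apply hm
  have h0 : (m 0).valMinAbs.natAbs = 0 ∧ (m 1).valMinAbs.natAbs = 0 := by
    omega
  rw [Int.natAbs_eq_zero, ZMod.valMinAbs_eq_zero, Int.natAbs_eq_zero, ZMod.valMinAbs_eq_zero] at h0
  funext i
  fin_cases i
  · exact h0.1
  · exact h0.2

/-- The sup-norm of a label of `(ℤ/Lℤ)²` is at most `L` (indeed `≤ L/2`). [folklore] -/
theorem latLinf_le {L : ℕ} [NeZero L] (m : TorusSite 2 L) :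
    max (m 0).valMinAbs.natAbs (m 1).valMinAbs.natAbs ≤ L := by
  have h0 := ZMod.natAbs_valMinAbs_le (m 0)
  have h1 := ZMod.natAbs_valMinAbs_le (m 1)
  omega

/-- `‖n‖_∞² ≤ ‖n‖₂²` for the representative of a label. [folklore] -/
theorem sq_latLinf_le_sum {L : ℕ} (m : TorusSite 2 L) :
    ((max (m 0).valMinAbs.natAbs (m 1).valMinAbs.natAbs : ℕ) : ℝ) ^ 2 ≤
      ∑ i, (((m i).valMinAbs : ℤ) : ℝ) ^ 2 := by
  rw [Fin.sum_univ_two]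
  have h0 : (((m 0).valMinAbs.natAbs : ℕ) : ℝ) ^ 2 = (((m 0).valMinAbs : ℤ) : ℝ) ^ 2 := by
    rw [Nat.cast_natAbs, Int.cast_abs, sq_abs]
  have h1 : (((m 1).valMinAbs.natAbs : ℕ) : ℝ) ^ 2 = (((m 1).valMinAbs : ℤ) : ℝ) ^ 2 := by
    rw [Nat.cast_natAbs, Int.cast_abs, sq_abs]
  rcases max_choice (m 0).valMinAbs.natAbs (m 1).valMinAbs.natAbs with h | h
  · rw [h, h0]; nlinarith [sq_nonneg (((m 1).valMinAbs : ℤ) : ℝ)]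
  · rw [h, h1]; nlinarith [sq_nonneg (((m 0).valMinAbs : ℤ) : ℝ)]

/-- `|q_m|² ≥ (2π/L)² ‖n‖_∞²`. [folklore] -/
theorem latLinf_sq_le_momentumNormSq {L : ℕ} (m : TorusSite 2 L) :
    (2 * Real.pi / (L : ℝ)) ^ 2 * ((max (m 0).valMinAbs.natAbs (m 1).valMinAbs.natAbs : ℕ) : ℝ) ^ 2 ≤
      momentumNormSq L m := by
  rw [momentumNormSq_apply]
  exact mul_le_mul_of_nonneg_left (sq_latLinf_le_sum m) (sq_nonneg _)

/-- **Fibre count.** At most `4(2j+1)` labels of `(ℤ/Lℤ)²` have sup-norm exactly `j`: the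
representative map `m ↦ n ∈ ℤ²` is injective (`ZMod.valMinAbs_inj`) and lands in the boundary
`({±j} × [-j, j]) ∪ ([-j, j] × {±j})` of the square of side `2j+1`. [folklore] -/
theorem latCard_fiber_le {L : ℕ} [NeZero L] (j : ℕ) :
    (Finset.univ.filter fun m : TorusSite 2 L =>
      max (m 0).valMinAbs.natAbs (m 1).valMinAbs.natAbs = j).card ≤ 4 * (2 * j + 1) := by
  classical
  let φ : TorusSite 2 L → ℤ × ℤ := fun m => ((m 0).valMinAbs, (m 1).valMinAbs)
  let I : Finset ℤ := Finset.Icc (-(j : ℤ)) j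
  let E : Finset ℤ := {-(j : ℤ), (j : ℤ)}
  have hI : I.card = 2 * j + 1 := by
    simp only [I, Int.card_Icc]
    omega
  have hE : E.card ≤ 2 := Finset.card_le_two
  calc (Finset.univ.filter fun m : TorusSite 2 L =>
          max (m 0).valMinAbs.natAbs (m 1).valMinAbs.natAbs = j).card
      ≤ (E ×ˢ I ∪ I ×ˢ E).card := by
        refine Finset.card_le_card_of_injOn φ ?_ ?_
        · intro m hm
          have hj : max (m 0).valMinAbs.natAbs (m 1).valMinAbs.natAbs = j :=
            (Finset.mem_filter.1 (Finset.mem_coe.1 hm)).2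
          simp only [Finset.coe_union, Finset.coe_product, Set.mem_union, Set.mem_prod,
            Finset.mem_coe, Finset.mem_insert, Finset.mem_singleton, Finset.mem_Icc, φ, E, I]
          omega
        · intro m _ m' _ h
          simp only [φ, Prod.mk.injEq, ZMod.valMinAbs_inj] at h
          funext i
          fin_cases i
          · exact h.1
          · exact h.2
    _ ≤ (E ×ˢ I).card + (I ×ˢ E).card := Finset.card_union_le _ _
    _ ≤ 2 * (2 * j + 1) + (2 * j + 1) * 2 := by
        rw [Finset.card_product, Finset.card_product, hI]
        gcongr
    _ = 4 * (2 * j + 1) := by ring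

/-! ## §2 Grouping a lattice sum by the sup-norm -/

/-- **Layer bound.** If every label `m ∈ S` has sup-norm in `T` and the summand at `m` is bounded by
a nonnegative function `b` of the sup-norm, then `Σ_{m ∈ S} f(m) ≤ Σ_{j ∈ T} 4(2j+1) b(j)`
(`Finset.sum_fiberwise_of_maps_to` and the fibre count `latCard_fiber_le`). [folklore] -/
theorem latSum_le_layers {L : ℕ} [NeZero L] (S : Finset (TorusSite 2 L)) (T : Finset ℕ)
    (f : TorusSite 2 L → ℝ) (b : ℕ → ℝ)
    (hT : ∀ m ∈ S, max (m 0).valMinAbs.natAbs (m 1).valMinAbs.natAbs ∈ T)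
    (hb : ∀ j ∈ T, 0 ≤ b j)
    (hf : ∀ m ∈ S, f m ≤ b (max (m 0).valMinAbs.natAbs (m 1).valMinAbs.natAbs)) :
    ∑ m ∈ S, f m ≤ ∑ j ∈ T, (4 * (2 * (j : ℝ) + 1)) * b j := by
  classical
  rw [← Finset.sum_fiberwise_of_maps_to hT f]
  refine Finset.sum_le_sum fun j hj => ?_
  calc (∑ m ∈ S with max (m 0).valMinAbs.natAbs (m 1).valMinAbs.natAbs = j, f m)
      ≤ ∑ m ∈ S with max (m 0).valMinAbs.natAbs (m 1).valMinAbs.natAbs = j, b j := by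
        refine Finset.sum_le_sum fun m hm => ?_
        obtain ⟨hmS, hmj⟩ := Finset.mem_filter.1 hm
        have h := hf m hmS
        rwa [hmj] at h
    _ = ((S.filter fun m => max (m 0).valMinAbs.natAbs (m 1).valMinAbs.natAbs = j).card : ℝ) * b j := by
        rw [Finset.sum_const, nsmul_eq_mul]
    _ ≤ (4 * (2 * (j : ℝ) + 1)) * b j := by
        apply mul_le_mul_of_nonneg_right _ (hb j hj)
        have h1 : (S.filter fun m => max (m 0).valMinAbs.natAbs (m 1).valMinAbs.natAbs = j).card ≤
            4 * (2 * j + 1) :=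
          (Finset.card_le_card (Finset.filter_subset_filter _ (Finset.subset_univ S))).trans
            (latCard_fiber_le j)
        exact_mod_cast h1

/-! ## §3 The two lattice sums -/

/-- The harmonic bound `Σ_{j=1}^{L} 1/j ≤ 1 + log L` (Mathlib `harmonic_le_one_add_log`). [folklore] -/
theorem latSum_one_div_le_log (L : ℕ) :
    (∑ j ∈ Finset.Icc 1 L, 1 / (j : ℝ)) ≤ 1 + Real.log (L : ℝ) := by
  have h := harmonic_le_one_add_log L
  simp_rw [harmonic_eq_sum_Icc, Rat.cast_sum, Rat.cast_inv, Rat.cast_natCast] at h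
  simpa only [one_div] using h

/-- **(ii) The punctured sum of `|q_m|⁻²` is `≤ L² (1 + log L)`**: group by the sup-norm `j ∈ [1, L]`,
bound each term by `L²/(4π²j²)` and each layer by `4(2j+1) ≤ 12j` labels, then use the harmonic
bound. [folklore] -/
theorem latFullSum_le (L : ℕ) [NeZero L] :
    (∑ m ∈ (Finset.univ.filter fun m : TorusSite 2 L => m ≠ 0), 1 / momentumNormSq L m) ≤
      (L : ℝ) ^ 2 * (1 + Real.log (L : ℝ)) := by
  have hL : (0 : ℝ) < L := Nat.cast_pos.2 (Nat.pos_of_ne_zero (NeZero.ne L))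
  have hπ := Real.pi_pos
  have hπ3 := Real.pi_gt_three
  have hlog : 0 ≤ 1 + Real.log (L : ℝ) := by
    have := Real.log_natCast_nonneg L
    linarith
  have hT : ∀ m ∈ (Finset.univ.filter fun m : TorusSite 2 L => m ≠ 0),
      max (m 0).valMinAbs.natAbs (m 1).valMinAbs.natAbs ∈ Finset.Icc 1 L := fun m hm =>
    Finset.mem_Icc.2 ⟨one_le_latLinf (Finset.mem_filter.1 hm).2, latLinf_le m⟩
  have hb : ∀ j ∈ Finset.Icc 1 L, (0 : ℝ) ≤ (L : ℝ) ^ 2 / ((2 * Real.pi) ^ 2 * (j : ℝ) ^ 2) :=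
    fun j _ => by positivity
  have hf : ∀ m ∈ (Finset.univ.filter fun m : TorusSite 2 L => m ≠ 0), 1 / momentumNormSq L m ≤
      (L : ℝ) ^ 2 / ((2 * Real.pi) ^ 2 *
        ((max (m 0).valMinAbs.natAbs (m 1).valMinAbs.natAbs : ℕ) : ℝ) ^ 2) := by
    intro m hm
    have hj : (1 : ℝ) ≤ ((max (m 0).valMinAbs.natAbs (m 1).valMinAbs.natAbs : ℕ) : ℝ) := by
      exact_mod_cast one_le_latLinf (Finset.mem_filter.1 hm).2
    have hjpos : (0 : ℝ) < ((max (m 0).valMinAbs.natAbs (m 1).valMinAbs.natAbs : ℕ) : ℝ) := by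
      linarith
    have hpos : (0 : ℝ) < (2 * Real.pi / (L : ℝ)) ^ 2 *
        ((max (m 0).valMinAbs.natAbs (m 1).valMinAbs.natAbs : ℕ) : ℝ) ^ 2 := by positivity
    calc 1 / momentumNormSq L m ≤ 1 / ((2 * Real.pi / (L : ℝ)) ^ 2 *
          ((max (m 0).valMinAbs.natAbs (m 1).valMinAbs.natAbs : ℕ) : ℝ) ^ 2) :=
          one_div_le_one_div_of_le hpos (latLinf_sq_le_momentumNormSq m)
      _ = (L : ℝ) ^ 2 / ((2 * Real.pi) ^ 2 *
          ((max (m 0).valMinAbs.natAbs (m 1).valMinAbs.natAbs : ℕ) : ℝ) ^ 2) := by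
          field_simp
  calc (∑ m ∈ (Finset.univ.filter fun m : TorusSite 2 L => m ≠ 0), 1 / momentumNormSq L m)
      ≤ ∑ j ∈ Finset.Icc 1 L, (4 * (2 * (j : ℝ) + 1)) * ((L : ℝ) ^ 2 / ((2 * Real.pi) ^ 2 * (j : ℝ) ^ 2)) :=
        latSum_le_layers _ _ _ (fun j : ℕ => (L : ℝ) ^ 2 / ((2 * Real.pi) ^ 2 * (j : ℝ) ^ 2)) hT hb hf
    _ ≤ ∑ j ∈ Finset.Icc 1 L, (3 * (L : ℝ) ^ 2 / Real.pi ^ 2) * (1 / (j : ℝ)) := by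
        refine Finset.sum_le_sum fun j hj => ?_
        have hj1 : (1 : ℝ) ≤ j := by exact_mod_cast (Finset.mem_Icc.1 hj).1
        have hjpos : (0 : ℝ) < j := by linarith
        calc (4 * (2 * (j : ℝ) + 1)) * ((L : ℝ) ^ 2 / ((2 * Real.pi) ^ 2 * (j : ℝ) ^ 2))
            ≤ (12 * (j : ℝ)) * ((L : ℝ) ^ 2 / ((2 * Real.pi) ^ 2 * (j : ℝ) ^ 2)) :=
              mul_le_mul_of_nonneg_right (by linarith) (by positivity)
          _ = (3 * (L : ℝ) ^ 2 / Real.pi ^ 2) * (1 / (j : ℝ)) := by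
              field_simp
              ring
    _ = (3 * (L : ℝ) ^ 2 / Real.pi ^ 2) * ∑ j ∈ Finset.Icc 1 L, 1 / (j : ℝ) := by
        rw [Finset.mul_sum]
    _ ≤ (3 * (L : ℝ) ^ 2 / Real.pi ^ 2) * (1 + Real.log (L : ℝ)) := by
        gcongr
        exact latSum_one_div_le_log L
    _ = (3 / Real.pi ^ 2) * ((L : ℝ) ^ 2 * (1 + Real.log (L : ℝ))) := by ring
    _ ≤ 1 * ((L : ℝ) ^ 2 * (1 + Real.log (L : ℝ))) := by
        gcongr
        rw [div_le_one (by positivity)]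
        nlinarith
    _ = (L : ℝ) ^ 2 * (1 + Real.log (L : ℝ)) := one_mul _

/-- **(i) The punctured-window sum of `|q_m|⁻¹` is `≤ η L²`**: `m ≠ 0` and `|q_m|² < η²` force the
sup-norm `j` into `[1, ηL/(2π)]`; bound each term by `L/(2πj)` and each layer by `4(2j+1) ≤ 12j`
labels, so the sum is `≤ ⌊ηL/(2π)⌋ · 6L/π ≤ (3/π²) η L²`. [folklore] -/
theorem latWindowSum_le (L : ℕ) [NeZero L] (η : ℝ) (hη : 0 < η) :
    (∑ m ∈ (Finset.univ.filter fun m : TorusSite 2 L => m ≠ 0 ∧ momentumNormSq L m < η ^ 2),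
      1 / Real.sqrt (momentumNormSq L m)) ≤ η * (L : ℝ) ^ 2 := by
  have hL : (0 : ℝ) < L := Nat.cast_pos.2 (Nat.pos_of_ne_zero (NeZero.ne L))
  have hπ := Real.pi_pos
  have hπ3 := Real.pi_gt_three
  set J : ℕ := ⌊η * (L : ℝ) / (2 * Real.pi)⌋₊ with hJ
  have hT : ∀ m ∈ (Finset.univ.filter fun m : TorusSite 2 L => m ≠ 0 ∧ momentumNormSq L m < η ^ 2),
      max (m 0).valMinAbs.natAbs (m 1).valMinAbs.natAbs ∈ Finset.Icc 1 J := by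
    intro m hm
    obtain ⟨hm0, hmη⟩ := (Finset.mem_filter.1 hm).2
    refine Finset.mem_Icc.2 ⟨one_le_latLinf hm0, Nat.le_floor ?_⟩
    have h1 : ((2 * Real.pi / (L : ℝ)) *
        ((max (m 0).valMinAbs.natAbs (m 1).valMinAbs.natAbs : ℕ) : ℝ)) ^ 2 < η ^ 2 := by
      rw [mul_pow]
      exact lt_of_le_of_lt (latLinf_sq_le_momentumNormSq m) hmη
    have h2 : (2 * Real.pi / (L : ℝ)) * ((max (m 0).valMinAbs.natAbs (m 1).valMinAbs.natAbs : ℕ) : ℝ) <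
        η := lt_of_pow_lt_pow_left₀ 2 hη.le h1
    rw [div_mul_eq_mul_div, div_lt_iff₀ hL] at h2
    rw [le_div_iff₀ (by positivity)]
    linarith
  have hb : ∀ j ∈ Finset.Icc 1 J, (0 : ℝ) ≤ (L : ℝ) / (2 * Real.pi * (j : ℝ)) :=
    fun j _ => by positivity
  have hf : ∀ m ∈ (Finset.univ.filter fun m : TorusSite 2 L => m ≠ 0 ∧ momentumNormSq L m < η ^ 2),
      1 / Real.sqrt (momentumNormSq L m) ≤
        (L : ℝ) / (2 * Real.pi * ((max (m 0).valMinAbs.natAbs (m 1).valMinAbs.natAbs : ℕ) : ℝ)) := by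
    intro m hm
    have hj : (1 : ℝ) ≤ ((max (m 0).valMinAbs.natAbs (m 1).valMinAbs.natAbs : ℕ) : ℝ) := by
      exact_mod_cast one_le_latLinf (Finset.mem_filter.1 hm).2.1
    have hjpos : (0 : ℝ) < ((max (m 0).valMinAbs.natAbs (m 1).valMinAbs.natAbs : ℕ) : ℝ) := by
      linarith
    have hlow : ((2 * Real.pi / (L : ℝ)) *
        ((max (m 0).valMinAbs.natAbs (m 1).valMinAbs.natAbs : ℕ) : ℝ)) ^ 2 ≤ momentumNormSq L m := by
      rw [mul_pow]
      exact latLinf_sq_le_momentumNormSq m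
    have hpos : (0 : ℝ) < (2 * Real.pi / (L : ℝ)) *
        ((max (m 0).valMinAbs.natAbs (m 1).valMinAbs.natAbs : ℕ) : ℝ) := by positivity
    calc 1 / Real.sqrt (momentumNormSq L m)
        ≤ 1 / Real.sqrt (((2 * Real.pi / (L : ℝ)) *
            ((max (m 0).valMinAbs.natAbs (m 1).valMinAbs.natAbs : ℕ) : ℝ)) ^ 2) :=
          one_div_le_one_div_of_le (by positivity) (Real.sqrt_le_sqrt hlow)
      _ = (L : ℝ) / (2 * Real.pi * ((max (m 0).valMinAbs.natAbs (m 1).valMinAbs.natAbs : ℕ) : ℝ)) := by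
          rw [Real.sqrt_sq hpos.le]
          field_simp
  calc (∑ m ∈ (Finset.univ.filter fun m : TorusSite 2 L => m ≠ 0 ∧ momentumNormSq L m < η ^ 2),
        1 / Real.sqrt (momentumNormSq L m))
      ≤ ∑ j ∈ Finset.Icc 1 J, (4 * (2 * (j : ℝ) + 1)) * ((L : ℝ) / (2 * Real.pi * (j : ℝ))) :=
        latSum_le_layers _ _ _ (fun j : ℕ => (L : ℝ) / (2 * Real.pi * (j : ℝ))) hT hb hf
    _ ≤ ∑ j ∈ Finset.Icc 1 J, 6 * (L : ℝ) / Real.pi := by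
        refine Finset.sum_le_sum fun j hj => ?_
        have hj1 : (1 : ℝ) ≤ j := by exact_mod_cast (Finset.mem_Icc.1 hj).1
        have hjpos : (0 : ℝ) < j := by linarith
        calc (4 * (2 * (j : ℝ) + 1)) * ((L : ℝ) / (2 * Real.pi * (j : ℝ)))
            ≤ (12 * (j : ℝ)) * ((L : ℝ) / (2 * Real.pi * (j : ℝ))) :=
              mul_le_mul_of_nonneg_right (by linarith) (by positivity)
          _ = 6 * (L : ℝ) / Real.pi := by
              field_simp
              ring
    _ = (J : ℝ) * (6 * (L : ℝ) / Real.pi) := by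
        rw [Finset.sum_const, Nat.card_Icc, nsmul_eq_mul]
        simp
    _ ≤ (η * (L : ℝ) / (2 * Real.pi)) * (6 * (L : ℝ) / Real.pi) := by
        gcongr
        exact Nat.floor_le (by positivity)
    _ = (3 / Real.pi ^ 2) * (η * (L : ℝ) ^ 2) := by
        field_simp
        ring
    _ ≤ 1 * (η * (L : ℝ) ^ 2) := by
        gcongr
        rw [div_le_one (by positivity)]
        nlinarith
    _ = η * (L : ℝ) ^ 2 := one_mul _

/-! ## §4 The registered stub -/

/-- **Stub LAT — `stub_windowLatticeSums` (pure 2-d lattice sums).** With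
`|q_m|² = momentumNormSq L m = (2π/L)² Σᵢ valMinAbs(mᵢ)²` on `(ℤ/Lℤ)²`: (i) the punctured-window sum
of `|q_m|⁻¹` is `≤ c (η L² + L)` for every window `η > 0` (count the labels with `‖n‖_∞ = j`,
`‖n‖₂ ≥ ‖n‖_∞`; `latWindowSum_le`), and (ii) the full punctured sum of `|q_m|⁻²` is
`≤ c L² (1 + log L)` (harmonic sum; `latFullSum_le`). One absolute constant `c` (here `c = 1`) for
both. [folklore] -/
theorem stub_windowLatticeSums :
    ∃ c : ℝ, 0 ≤ c ∧ (∀ (L : ℕ) [NeZero L] (η : ℝ), 0 < η → (∑ m ∈ (Finset.univ.filter fun m : TorusSite 2 L => m ≠ 0 ∧ momentumNormSq L m < η ^ 2), 1 / Real.sqrt (momentumNormSq L m)) ≤ c * (η * (L : ℝ) ^ 2 + (L : ℝ))) ∧ (∀ (L : ℕ) [NeZero L], (∑ m ∈ (Finset.univ.filter fun m : TorusSite 2 L => m ≠ 0), 1 / momentumNormSq L m) ≤ c * (L : ℝ) ^ 2 * (1 + Real.log (L : ℝ))) := by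
  refine ⟨1, zero_le_one, fun L _ η hη => ?_, fun L _ => ?_⟩
  · have hL : (0 : ℝ) ≤ L := Nat.cast_nonneg L
    calc _ ≤ η * (L : ℝ) ^ 2 := latWindowSum_le L η hη
      _ ≤ 1 * (η * (L : ℝ) ^ 2 + (L : ℝ)) := by rw [one_mul]; linarith
  · rw [one_mul]
    exact latFullSum_le L

end Summit.HubbardSuperconductivity.HubbardSuperconductivity.Theorems.WcbcsSsbToTorusLRO

end
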